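/-
Copyright: lit-balaban cell (HOME `run/shared/lean/pub/lit-balaban/`), Phase-2 proof seat p12 (gen 7).  The proofs reproduce the
printed arguments; nothing is claimed beyond what the kernel checks below.
-/
import Literature.MathematicalPhysics.QuantumFieldTheory.DybalskiStottmeisterTanimoto2024.DST24CriticalPoint

/-!
# `DybalskiStottmeisterTanimoto2024.DST24GreenFunction` — [DybalskiStottmeisterTanimoto2024] **§3.3 (Green) / §4.2 Lemma
# (inverse-lemma)** PROVED in `𝓛²` form: `−Δ_Ω + Q*Q ≥ C` with `C = (8L⁴)⁻¹` uniformly in `n` ((unit-box), (many-boxes)), the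
# lattice Green function `Γ := (−Δ_Ω + Q*Q)⁻¹` exists, `Γ > 0` and `QΓQ*` is invertible on `𝓛²(Ω₁)`

statement-level skeleton of published theorems with citation tags; proofs where landed; nothing here is a claim about
the Yang–Mills mass gap

W. Dybalski, A. Stottmeister, Y. Tanimoto, *The Bałaban variational problem in the non-linear sigma model*, Rev. Math. Phys.
**36** (2024), arXiv:2403.09800; source held `paper:arxiv-2403.09800` (§3.3 (Green) = tex chunk p0009; §4.2 Lemma (inverse-lemma)
= p0012–p0013).  Unit `lit-balaban-p12` (gen 7); `∂`, `∂*`, `Δ_Ω`, `Q`, `Q*` from `DST24CriticalPoint`/`DST24LinearConstraint`.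

WHAT IS PRINTED AND PROVED HERE.
* (Green) «we … define the lattice Green function `Γ := (−Δ_Ω + Q*Q)⁻¹`.  The existence of the inverse defining `Γ` is a standard
  fact, see Lemma (inverse-lemma) below.» — `Mfun`/`Mop` (`= −Δ_Ω + Q*Q = ∂*∂ + Q*Q`), `Mop_injective`, `Gamma` with `Mfun_Gamma`,
  `Gamma_Mfun`.
* Lemma (inverse-lemma): 1. (unit-box) «`−Δ_{B(y)} + Q*Q ≥ C` on `𝓛²(B(y))`», 2. (many-boxes) «`−Δ_Ω + Q*Q ≥ C`» with «`C, c > 0`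
  independent of `n`, but `C` may depend on `L`» — `unit_box`, `many_boxes` with the explicit `C = (8L⁴)⁻¹`, obtained as in the
  print from a spectral gap of the Neumann box Laplacian on the complement of constants (here a Poincaré inequality on the box,
  `norm_sub_mean_le`, proved by summing `∂f` along lattice paths inside the box, instead of the exact lowest eigenvalue
  `4sin²(π/2L)`) and «the Neumann boundary conditions … to justify that we can drop the bonds linking different boxes» (`sum_Sbox_le`);
  2.–3. qualitatively: «`(−Δ_Ω + Q*Q)⁻¹ ≥ c`», (sandwiched-Green) «`Q(−Δ_Ω + Q*Q)⁻¹Q* ≥ c`» in the form `Γ > 0`, `QΓQ* > 0`, hence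
  `QΓQ*` invertible — `ipS_Gamma_pos`, `ipC_QGammaQstar_pos`, `QGammaQstar_injective`, `QGammaQstar` (a linear automorphism of
  `𝓛²(Ω₁)`).  The explicit constants `c` of (Green-estimate)/(sandwiched-Green) need the bound (bounded-Laplacian) `‖Δ_Ω‖ ≤ 4`
  — not in this file.
-/

namespace Literature.MathematicalPhysics.QuantumFieldTheory.DybalskiStottmeisterTanimoto2024.DST24GreenFunction

open scoped Quaternion RealInnerProductSpace BigOperators
open Literature.MathematicalPhysics.QuantumFieldTheory.Federbush1986
open Literature.MathematicalPhysics.QuantumFieldTheory.DybalskiStottmeisterTanimoto2024.DST24Setting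
open Literature.MathematicalPhysics.QuantumFieldTheory.DybalskiStottmeisterTanimoto2024.DST24Configurations
open Literature.MathematicalPhysics.QuantumFieldTheory.DybalskiStottmeisterTanimoto2024.DST24LinearConstraint
open Literature.MathematicalPhysics.QuantumFieldTheory.DybalskiStottmeisterTanimoto2024.DST24TangentSpace
open Literature.MathematicalPhysics.QuantumFieldTheory.DybalskiStottmeisterTanimoto2024.DST24CriticalPoint

noncomputable section

variable {L n₁ : ℕ}

/-! ## Linearity of `∂`, `∂*`, `Q*` -/

section Linear

variable {M : Type*} [AddCommGroup M] [Module ℝ M]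

/-- `∂(cf) = c∂f`. [cite: DybalskiStottmeisterTanimoto2024, §3.3 (derivative)] -/
theorem del_smul (c : ℝ) (f : Site L n₁ → M) : del (c • f) = c • del f := by
  funext b; simp only [del, Pi.smul_apply, smul_sub]

/-- `∂*(cg) = c∂*g`. [cite: DybalskiStottmeisterTanimoto2024, §3.3 (adjoint)] -/
theorem delStar_smul (c : ℝ) (g : Bond L n₁ → M) : delStar (c • g) = c • delStar g := by
  funext x
  simp only [delStar, Pi.smul_apply, smul_sub, Finset.smul_sum, smul_ite, smul_zero]

omit [Module ℝ M] in
/-- `Q*(g + g′) = Q*g + Q*g′`. [cite: DybalskiStottmeisterTanimoto2024, §2.1 (2.6)] -/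
theorem Qstar_add (g g' : CSite n₁ → M) : Qstar L (g + g') = Qstar L g + Qstar L g' := rfl

/-- `Q*(cg) = cQ*g`. [cite: DybalskiStottmeisterTanimoto2024, §2.1 (2.6)] -/
theorem Qstar_smul (c : ℝ) (g : CSite n₁ → M) : Qstar L (c • g) = c • Qstar L g := rfl

end Linear

/-! ## Summing `∂f` along lattice paths inside a box (the Neumann box Laplacian sees only bonds inside `B(y)`) -/

/-- If `‖f(b₋) − f(b₊)‖ ≤ δ` for the bonds inside `B(y)`, then `‖f(x) − f(x′)‖ ≤ ℓ¹(x,x′)·δ` for `x, x′ ∈ B(y)` (telescoping along a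
shortest lattice path, which stays in the box) — the additive form of §2.2 Lemma (chain), used for the box Poincaré inequality behind
(unit-box). [cite: DybalskiStottmeisterTanimoto2024, §2.2 Lemma (chain), proof; §4.2 Lemma (inverse-lemma) 1.] -/
theorem norm_sub_le_l1_mul' (hL : 0 < L) {E : Type*} [SeminormedAddCommGroup E] (f : Site L n₁ → E) {y : CSite n₁} {δ : ℝ}
    (hδ : ∀ b : Bond L n₁, b.src ∈ box L y → b.tgt ∈ box L y → ‖f b.src - f b.tgt‖ ≤ δ) :
    ∀ n : ℕ, ∀ x x' : Site L n₁, x ∈ box L y → x' ∈ box L y → l1 x x' = n → ‖f x - f x'‖ ≤ n * δ := by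
  intro n
  induction n with
  | zero =>
    intro x x' _ _ h0
    rw [(l1_eq_zero_iff x x').mp h0, sub_self, norm_zero, Nat.cast_zero, zero_mul]
  | succ n ih =>
    intro x x' hx hx' hn
    have hne : x ≠ x' := by
      intro h; rw [(l1_eq_zero_iff x x').mpr h] at hn; exact absurd hn (by omega)
    obtain ⟨μ, hμ⟩ : ∃ μ, x μ ≠ x' μ := by
      by_contra h
      exact hne (funext fun ν => by_contra fun hν => h ⟨ν, hν⟩)
    have hxμ := (mem_box_iff hL).mp hx μ
    have hx'μ := (mem_box_iff hL).mp hx' μ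
    have hx'lt := (x' μ).isLt
    have hxlt := (x μ).isLt
    rcases lt_or_gt_of_ne (Fin.val_ne_of_ne hμ) with hlt | hgt
    · -- step up: `x'' = x + e_μ`, the bond `b = (x, x'')`
      let v : Fin (L * n₁) := ⟨(x μ : ℕ) + 1, by omega⟩
      let b : Bond L n₁ := ⟨(x, μ), show (x μ : ℕ) + 1 < L * n₁ by omega⟩
      have hsrc : b.src = x := rfl
      have htgt : b.tgt = Function.update x μ v := rfl
      have h'' : Function.update x μ v ∈ box L y := by
        rw [mem_box_iff hL]
        intro ν
        by_cases hν : ν = μ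
        · subst hν; rw [Function.update_self]; change L * _ ≤ (x ν : ℕ) + 1 ∧ (x ν : ℕ) + 1 < _; omega
        · rw [Function.update_of_ne hν]; exact (mem_box_iff hL).mp hx ν
      have hl1 : l1 (Function.update x μ v) x' = n := by
        have e := l1_update x x' μ v
        change l1 (Function.update x μ v) x' + _ = l1 x x' + (((x μ : ℕ) + 1 - (x' μ : ℕ)) + ((x' μ : ℕ) - ((x μ : ℕ) + 1)))
          at e
        omega
      calc ‖f x - f x'‖
          = ‖(f x - f b.tgt) + (f b.tgt - f x')‖ := by rw [sub_add_sub_cancel]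
        _ ≤ ‖f x - f b.tgt‖ + ‖f b.tgt - f x'‖ := norm_add_le _ _
        _ ≤ δ + n * δ := add_le_add (hsrc ▸ hδ b (hsrc ▸ hx) (htgt ▸ h'')) (ih _ _ (htgt ▸ h'') hx' (htgt ▸ hl1))
        _ = (n + 1 : ℕ) * δ := by push_cast; ring
    · -- step down: `x'' = x − e_μ`, the bond `b = (x'', x)`
      let v : Fin (L * n₁) := ⟨(x μ : ℕ) - 1, by omega⟩
      let b : Bond L n₁ := ⟨(Function.update x μ v, μ), show ((Function.update x μ v μ : Fin (L * n₁)) : ℕ) + 1 < L * n₁ by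
        rw [Function.update_self]; change (x μ : ℕ) - 1 + 1 < _; omega⟩
      have hsrc : b.src = Function.update x μ v := rfl
      have htgt : b.tgt = x := by
        funext ν
        by_cases hν : ν = μ
        · subst hν
          apply Fin.ext
          have h1 : ((b.tgt b.dir : Fin (L * n₁)) : ℕ) = (b.src b.dir : ℕ) + 1 := b.tgt_apply_dir
          change ((b.tgt ν : Fin (L * n₁)) : ℕ) = ((Function.update x ν v ν : Fin (L * n₁)) : ℕ) + 1 at h1
          rw [h1, Function.update_self]
          change (x ν : ℕ) - 1 + 1 = _
          omega
        · exact (b.tgt_apply_of_ne (by exact hν)).trans (by rw [hsrc, Function.update_of_ne hν])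
      have h'' : Function.update x μ v ∈ box L y := by
        rw [mem_box_iff hL]
        intro ν
        by_cases hν : ν = μ
        · subst hν; rw [Function.update_self]; change L * _ ≤ (x ν : ℕ) - 1 ∧ (x ν : ℕ) - 1 < _; omega
        · rw [Function.update_of_ne hν]; exact (mem_box_iff hL).mp hx ν
      have hl1 : l1 (Function.update x μ v) x' = n := by
        have e := l1_update x x' μ v
        change l1 (Function.update x μ v) x' + _ = l1 x x' + (((x μ : ℕ) - 1 - (x' μ : ℕ)) + ((x' μ : ℕ) - ((x μ : ℕ) - 1)))
          at e
        omega
      have hb : ‖f b.src - f b.tgt‖ ≤ δ := hδ b (hsrc ▸ h'') (htgt ▸ hx)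
      rw [htgt] at hb
      calc ‖f x - f x'‖
          = ‖(f x - f b.src) + (f b.src - f x')‖ := by rw [sub_add_sub_cancel]
        _ ≤ ‖f x - f b.src‖ + ‖f b.src - f x'‖ := norm_add_le _ _
        _ ≤ δ + n * δ := by
              refine add_le_add ?_ (ih _ _ (hsrc ▸ h'') hx' (hsrc ▸ hl1))
              rw [← norm_neg, neg_sub]
              exact hb
        _ = (n + 1 : ℕ) * δ := by push_cast; ring

/-- `‖f(x) − f(x′)‖ ≤ 2L·δ` for `x, x′` in one box when `‖∂f‖ ≤ δ` on the bonds inside it. [cite: DybalskiStottmeisterTanimoto2024, §2.2 Lemma (chain); §4.2 Lemma (inverse-lemma) 1.] -/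
theorem norm_sub_le_of_mem_box' (hL : 0 < L) {E : Type*} [SeminormedAddCommGroup E] (f : Site L n₁ → E) {y : CSite n₁} {δ : ℝ}
    (hδ0 : 0 ≤ δ) (hδ : ∀ b : Bond L n₁, b.src ∈ box L y → b.tgt ∈ box L y → ‖f b.src - f b.tgt‖ ≤ δ) {x x' : Site L n₁}
    (hx : x ∈ box L y) (hx' : x' ∈ box L y) : ‖f x - f x'‖ ≤ 2 * L * δ := by
  have h := norm_sub_le_l1_mul' hL f hδ (l1 x x') x x' hx hx' rfl
  have hl : l1 x x' ≤ 2 * (L - 1) := l1_le_of_mem_box hL hx hx'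
  have hl' : (l1 x x' : ℝ) ≤ 2 * L := by
    have : l1 x x' ≤ 2 * L := by omega
    exact_mod_cast this
  exact h.trans (mul_le_mul_of_nonneg_right hl' hδ0)

/-! ## Lemma (inverse-lemma) 1.–2.: the box Poincaré inequality and (unit-box), (many-boxes) -/

section InverseLemma

variable {E : Type*} [NormedAddCommGroup E] [InnerProductSpace ℝ E]

/-- The bonds inside the box `B(y)` (those kept by «the Neumann boundary conditions» of `Δ_{B(y)}`).
[cite: DybalskiStottmeisterTanimoto2024, §4.2 Lemma (inverse-lemma), proof of 2. («we can drop the bonds linking different boxes `B(y)`»)] -/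
def boxBonds (L : ℕ) (y : CSite n₁) : Finset (Bond L n₁) :=
  Finset.univ.filter fun b => b.src ∈ box L y ∧ b.tgt ∈ box L y

/-- `b ∈ boxBonds y ↔ b₋, b₊ ∈ B(y)`. [cite: DybalskiStottmeisterTanimoto2024, §4.2 Lemma (inverse-lemma), proof of 2.] -/
theorem mem_boxBonds {y : CSite n₁} {b : Bond L n₁} : b ∈ boxBonds L y ↔ b.src ∈ box L y ∧ b.tgt ∈ box L y := by
  simp [boxBonds]

/-- `S_y(f) := Σ_{b ⊂ B(y)} ‖∂f(b)‖² = ⟨f, −Δ_{B(y)}f⟩`. [cite: DybalskiStottmeisterTanimoto2024, §4.2 Lemma (inverse-lemma) 1. («`⟨f, (−Δ_{B(y)})f⟩`»)] -/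
def Sbox (f : Site L n₁ → E) (y : CSite n₁) : ℝ := ∑ b ∈ boxBonds L y, ‖del f b‖ ^ 2

omit [InnerProductSpace ℝ E] in
/-- `S_y ≥ 0`. [cite: DybalskiStottmeisterTanimoto2024, §4.2 Lemma (inverse-lemma) 1.] -/
theorem Sbox_nonneg (f : Site L n₁ → E) (y : CSite n₁) : 0 ≤ Sbox f y :=
  Finset.sum_nonneg fun _ _ => sq_nonneg _

omit [InnerProductSpace ℝ E] in
/-- Each box bond is bounded by the box energy: `‖∂f(b)‖ ≤ √S_y`. [cite: DybalskiStottmeisterTanimoto2024, §4.2 Lemma (inverse-lemma) 1.] -/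
theorem norm_del_le_sqrt_Sbox (f : Site L n₁ → E) {y : CSite n₁} {b : Bond L n₁} (hb : b ∈ boxBonds L y) :
    ‖del f b‖ ≤ Real.sqrt (Sbox f y) := by
  rw [← Real.sqrt_sq (norm_nonneg (del f b))]
  exact Real.sqrt_le_sqrt (Finset.single_le_sum (fun b _ => sq_nonneg (‖del f b‖)) hb)

omit [InnerProductSpace ℝ E] in
/-- `‖f(x) − f(x′)‖ ≤ 2L√S_y` inside a box. [cite: DybalskiStottmeisterTanimoto2024, §4.2 Lemma (inverse-lemma) 1. («`−Δ_{B(y)}` is strictly positive on the orthogonal complement of the subspace of constant functions»)] -/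
theorem norm_sub_le_sqrt_Sbox (hL : 0 < L) (f : Site L n₁ → E) {y : CSite n₁} {x x' : Site L n₁} (hx : x ∈ box L y)
    (hx' : x' ∈ box L y) : ‖f x - f x'‖ ≤ 2 * L * Real.sqrt (Sbox f y) :=
  norm_sub_le_of_mem_box' hL f (Real.sqrt_nonneg _)
    (fun _ hs ht => norm_del_le_sqrt_Sbox f (mem_boxBonds.mpr ⟨hs, ht⟩)) hx hx'

/-- `f(x) − (Qf)(y) = L⁻² Σ_{x′∈B(y)} (f(x) − f(x′))` for `x ∈ B(y)`. [cite: DybalskiStottmeisterTanimoto2024, §2.1 (2.5); §4.2 Lemma (inverse-lemma) 1.] -/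
theorem sub_Q_eq (hL : 0 < L) (f : Site L n₁ → E) (y : CSite n₁) (x : Site L n₁) :
    f x - Q L f y = ((L : ℝ) ^ 2)⁻¹ • ∑ x' ∈ box L y, (f x - f x') := by
  have hL2 : ((L : ℝ) ^ 2) ≠ 0 := by positivity
  rw [Finset.sum_sub_distrib, Finset.sum_const, card_box, smul_sub, Q_apply, ← Nat.cast_smul_eq_nsmul ℝ, smul_smul,
    Nat.cast_pow, inv_mul_cancel₀ hL2, one_smul]

/-- Box Poincaré inequality: `‖f(x) − (Qf)(y)‖ ≤ 2L√S_y` for `x ∈ B(y)`. [cite: DybalskiStottmeisterTanimoto2024, §4.2 Lemma (inverse-lemma) 1.] -/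
theorem norm_sub_Q_le (hL : 0 < L) (f : Site L n₁ → E) {y : CSite n₁} {x : Site L n₁} (hx : x ∈ box L y) :
    ‖f x - Q L f y‖ ≤ 2 * L * Real.sqrt (Sbox f y) := by
  have hL2 : (0 : ℝ) < (L : ℝ) ^ 2 := by positivity
  rw [sub_Q_eq hL f y x, norm_smul, norm_inv, Real.norm_of_nonneg hL2.le]
  calc ((L : ℝ) ^ 2)⁻¹ * ‖∑ x' ∈ box L y, (f x - f x')‖
      ≤ ((L : ℝ) ^ 2)⁻¹ * ∑ x' ∈ box L y, ‖f x - f x'‖ :=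
        mul_le_mul_of_nonneg_left (norm_sum_le _ _) (inv_nonneg.mpr hL2.le)
    _ ≤ ((L : ℝ) ^ 2)⁻¹ * ∑ x' ∈ box L y, 2 * L * Real.sqrt (Sbox f y) :=
        mul_le_mul_of_nonneg_left (Finset.sum_le_sum fun x' hx' => norm_sub_le_sqrt_Sbox hL f hx hx') (inv_nonneg.mpr hL2.le)
    _ = 2 * L * Real.sqrt (Sbox f y) := by
        rw [Finset.sum_const, card_box, nsmul_eq_mul, Nat.cast_pow, ← mul_assoc, inv_mul_cancel₀ hL2.ne', one_mul]

/-- `‖f(x)‖² ≤ 8L²S_y + 2‖(Qf)(y)‖²` for `x ∈ B(y)`. [cite: DybalskiStottmeisterTanimoto2024, §4.2 Lemma (inverse-lemma) 1. (unit-box)] -/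
theorem norm_sq_le (hL : 0 < L) (f : Site L n₁ → E) {y : CSite n₁} {x : Site L n₁} (hx : x ∈ box L y) :
    ‖f x‖ ^ 2 ≤ 8 * (L : ℝ) ^ 2 * Sbox f y + 2 * ‖Q L f y‖ ^ 2 := by
  have h1 := norm_sub_Q_le hL f hx
  have h2 : ‖f x‖ ≤ ‖f x - Q L f y‖ + ‖Q L f y‖ := by
    have := norm_add_le (f x - Q L f y) (Q L f y)
    rwa [sub_add_cancel] at this
  have hS := Sbox_nonneg f y
  have h3 : Real.sqrt (Sbox f y) ^ 2 = Sbox f y := Real.sq_sqrt hS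
  have ha := norm_nonneg (f x - Q L f y)
  have h4 : ‖f x‖ ^ 2 ≤ (‖f x - Q L f y‖ + ‖Q L f y‖) ^ 2 := pow_le_pow_left₀ (norm_nonneg _) h2 2
  have h5 : ‖f x - Q L f y‖ ^ 2 ≤ (2 * L * Real.sqrt (Sbox f y)) ^ 2 := pow_le_pow_left₀ ha h1 2
  nlinarith [sq_nonneg (‖f x - Q L f y‖ - ‖Q L f y‖)]

/-- **Lemma (inverse-lemma) 1. (unit-box)**, `𝓛²` form with explicit constant: «`−Δ_{B(y)} + Q*Q ≥ C` on `𝓛²(B(y))`» as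
`Σ_{x∈B(y)} ‖f(x)‖² ≤ 8L⁴ ⟨f, −Δ_{B(y)}f⟩ + 2L²‖(Qf)(y)‖²` (and `⟨f, Q*Qf⟩_{B(y)} = L²‖(Qf)(y)‖²`).
[cite: DybalskiStottmeisterTanimoto2024, §4.2 Lemma (inverse-lemma) 1. (unit-box)] -/
theorem unit_box (hL : 0 < L) (f : Site L n₁ → E) (y : CSite n₁) :
    ∑ x ∈ box L y, ‖f x‖ ^ 2 ≤ 8 * (L : ℝ) ^ 4 * Sbox f y + 2 * (L : ℝ) ^ 2 * ‖Q L f y‖ ^ 2 := by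
  calc ∑ x ∈ box L y, ‖f x‖ ^ 2
      ≤ ∑ x ∈ box L y, (8 * (L : ℝ) ^ 2 * Sbox f y + 2 * ‖Q L f y‖ ^ 2) := Finset.sum_le_sum fun x hx => norm_sq_le hL f hx
    _ = 8 * (L : ℝ) ^ 4 * Sbox f y + 2 * (L : ℝ) ^ 2 * ‖Q L f y‖ ^ 2 := by
        rw [Finset.sum_const, card_box, nsmul_eq_mul, Nat.cast_pow]; ring

/-- «we can drop the bonds linking different boxes»: `Σ_y S_y ≤ Σ_{b∈Ω′} ‖∂f(b)‖² = ⟨∂f, ∂f⟩_{Ω′}`.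
[cite: DybalskiStottmeisterTanimoto2024, §4.2 Lemma (inverse-lemma), proof of 2. (D-N-bracketing)] -/
theorem sum_Sbox_le (f : Site L n₁ → E) : ∑ y, Sbox f y ≤ ipB (del f) (del f) := by
  unfold Sbox ipB
  simp only [real_inner_self_eq_norm_sq]
  have e : ∀ y : CSite n₁, ∑ b ∈ boxBonds L y, ‖del f b‖ ^ 2 =
      ∑ b : Bond L n₁, if b.src ∈ box L y ∧ b.tgt ∈ box L y then ‖del f b‖ ^ 2 else 0 := fun y => Finset.sum_filter _ _
  simp only [e]
  rw [Finset.sum_comm]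
  refine Finset.sum_le_sum fun b _ => ?_
  calc ∑ y : CSite n₁, (if b.src ∈ box L y ∧ b.tgt ∈ box L y then ‖del f b‖ ^ 2 else 0)
      ≤ ∑ y : CSite n₁, (if y = blk b.src then ‖del f b‖ ^ 2 else 0) := Finset.sum_le_sum fun y _ => by
          by_cases hP : b.src ∈ box L y ∧ b.tgt ∈ box L y
          · rw [if_pos hP, if_pos (mem_box.mp hP.1).symm]
          · rw [if_neg hP]; split_ifs <;> positivity
    _ = ‖del f b‖ ^ 2 := by rw [Finset.sum_ite_eq' Finset.univ (blk b.src), if_pos (Finset.mem_univ _)]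

/-- `⟨f, f⟩_Ω = Σ_x ‖f(x)‖²`. [cite: DybalskiStottmeisterTanimoto2024, Notation («`‖f‖_{2;Ω}`»)] -/
theorem ipS_self (f : Site L n₁ → E) : ipS f f = ∑ x, ‖f x‖ ^ 2 := by
  unfold ipS; simp only [real_inner_self_eq_norm_sq]

/-- `⟨g, g⟩_{Ω₁} = L² Σ_y ‖g(y)‖²`. [cite: DybalskiStottmeisterTanimoto2024, Notation («`‖g‖_{2;Ω₁}`»)] -/
theorem ipC_self (g : CSite n₁ → E) : ipC L g g = (L : ℝ) ^ 2 * ∑ y, ‖g y‖ ^ 2 := by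
  unfold ipC; simp only [real_inner_self_eq_norm_sq]

/-- (Green) the operator `−Δ_Ω + Q*Q = ∂*∂ + Q*Q` as a function. [cite: DybalskiStottmeisterTanimoto2024, §3.3 (Green)] -/
def Mfun (L : ℕ) (f : Site L n₁ → E) : Site L n₁ → E := delStar (del f) + Qstar L (Q L f)

/-- `(−Δ_Ω + Q*Q)f = ∂*∂f + Q*Qf = −Δ_Ωf + Q*Qf`. [cite: DybalskiStottmeisterTanimoto2024, §3.3 (Green), (Laplacian)] -/
theorem Mfun_apply (f : Site L n₁ → E) : Mfun L f = -laplace f + Qstar L (Q L f) := by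
  unfold Mfun laplace; rw [neg_neg]

/-- `⟨f, g + g′⟩_Ω = ⟨f, g⟩_Ω + ⟨f, g′⟩_Ω`. [cite: DybalskiStottmeisterTanimoto2024, Notation] -/
theorem ipS_add_right (f g g' : Site L n₁ → E) : ipS f (g + g') = ipS f g + ipS f g' := by
  unfold ipS; simp only [Pi.add_apply, inner_add_right, Finset.sum_add_distrib]

/-- `⟨f, g⟩_Ω = ⟨g, f⟩_Ω`. [cite: DybalskiStottmeisterTanimoto2024, Notation] -/
theorem ipS_comm (f g : Site L n₁ → E) : ipS f g = ipS g f := by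
  unfold ipS; exact Finset.sum_congr rfl fun x _ => real_inner_comm _ _

/-- `⟨f, (−Δ_Ω + Q*Q)f⟩_Ω = ⟨∂f, ∂f⟩_{Ω′} + ⟨Qf, Qf⟩_{Ω₁}`. [cite: DybalskiStottmeisterTanimoto2024, §4.2 Lemma (inverse-lemma), proof of 2.] -/
theorem ipS_Mfun (hL : 0 < L) (f : Site L n₁ → E) : ipS f (Mfun L f) = ipB (del f) (del f) + ipC L (Q L f) (Q L f) := by
  unfold Mfun
  rw [ipS_add_right, ← ipB_del, ipC_Q_eq_ipS_Qstar hL]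

/-- **Lemma (inverse-lemma) 2. (many-boxes)**, `𝓛²` form with explicit constant: «`−Δ_Ω + Q*Q ≥ C`», here
`⟨f, f⟩_Ω ≤ 8L⁴ ⟨f, (−Δ_Ω + Q*Q)f⟩_Ω`, uniformly in `n`. [cite: DybalskiStottmeisterTanimoto2024, §4.2 Lemma (inverse-lemma) 2. (many-boxes)] -/
theorem many_boxes (hL : 0 < L) (f : Site L n₁ → E) : ipS f f ≤ 8 * (L : ℝ) ^ 4 * ipS f (Mfun L f) := by
  have hLr : (1 : ℝ) ≤ L := by exact_mod_cast hL
  rw [ipS_self, ipS_Mfun hL, ipC_self, sum_eq_sum_box]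
  have h1 : ∑ y, ∑ x ∈ box L y, ‖f x‖ ^ 2 ≤ ∑ y, (8 * (L : ℝ) ^ 4 * Sbox f y + 2 * (L : ℝ) ^ 2 * ‖Q L f y‖ ^ 2) :=
    Finset.sum_le_sum fun y _ => unit_box hL f y
  have h2 := sum_Sbox_le f
  have h3 : 0 ≤ ∑ y, ‖Q L f y‖ ^ 2 := Finset.sum_nonneg fun _ _ => sq_nonneg _
  rw [Finset.sum_add_distrib, ← Finset.mul_sum, ← Finset.mul_sum] at h1
  have hL4 : (1 : ℝ) ≤ (L : ℝ) ^ 4 := one_le_pow₀ hLr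
  have h4 : 2 * (L : ℝ) ^ 2 ≤ 8 * (L : ℝ) ^ 4 * (L : ℝ) ^ 2 := by nlinarith [sq_nonneg (L : ℝ)]
  calc ∑ y, ∑ x ∈ box L y, ‖f x‖ ^ 2
      ≤ 8 * (L : ℝ) ^ 4 * ∑ y, Sbox f y + 2 * (L : ℝ) ^ 2 * ∑ y, ‖Q L f y‖ ^ 2 := h1
    _ ≤ 8 * (L : ℝ) ^ 4 * ipB (del f) (del f) + 8 * (L : ℝ) ^ 4 * (L : ℝ) ^ 2 * ∑ y, ‖Q L f y‖ ^ 2 :=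
        add_le_add (mul_le_mul_of_nonneg_left h2 (by positivity)) (mul_le_mul_of_nonneg_right h4 h3)
    _ = 8 * (L : ℝ) ^ 4 * (ipB (del f) (del f) + (L : ℝ) ^ 2 * ∑ y, ‖Q L f y‖ ^ 2) := by ring

/-- `(−Δ_Ω + Q*Q)f = 0 ⇒ f = 0`. [cite: DybalskiStottmeisterTanimoto2024, §3.3 (Green) («The existence of the inverse defining `Γ` is a standard fact»)] -/
theorem eq_zero_of_Mfun_eq_zero (hL : 0 < L) {f : Site L n₁ → E} (h : Mfun L f = 0) : f = 0 := by
  have h1 := many_boxes hL f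
  rw [h] at h1
  have h0 : ipS f (0 : Site L n₁ → E) = 0 := by unfold ipS; simp
  rw [h0, mul_zero, ipS_self] at h1
  funext x
  have hx : ‖f x‖ ^ 2 ≤ 0 :=
    (Finset.single_le_sum (fun x _ => sq_nonneg (‖f x‖)) (Finset.mem_univ x)).trans h1
  have : ‖f x‖ = 0 := by nlinarith [norm_nonneg (f x)]
  exact norm_eq_zero.mp this

/-- (Green) `−Δ_Ω + Q*Q` as a linear operator on `𝓛²(Ω; E)`. [cite: DybalskiStottmeisterTanimoto2024, §3.3 (Green)] -/
def Mop (L : ℕ) : (Site L n₁ → E) →ₗ[ℝ] (Site L n₁ → E) where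
  toFun := Mfun L
  map_add' f f' := by
    unfold Mfun
    rw [del_add, delStar_add, Q_add, Qstar_add]
    abel
  map_smul' c f := by
    unfold Mfun
    rw [del_smul, delStar_smul, Q_smul, Qstar_smul, RingHom.id_apply, smul_add]

/-- `Mop L f = Mfun L f`. [cite: DybalskiStottmeisterTanimoto2024, §3.3 (Green)] -/
@[simp] theorem Mop_apply (f : Site L n₁ → E) : Mop L f = Mfun L f := rfl

/-- `−Δ_Ω + Q*Q` is injective. [cite: DybalskiStottmeisterTanimoto2024, §3.3 (Green); §4.2 Lemma (inverse-lemma) 2.] -/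
theorem Mop_injective (hL : 0 < L) : Function.Injective (Mop L : (Site L n₁ → E) →ₗ[ℝ] (Site L n₁ → E)) := by
  intro f g h
  have h' : Mfun L f = Mfun L g := h
  have : Mfun L (f - g) = 0 := by
    have := (Mop L).map_sub f g
    rw [Mop_apply, Mop_apply, Mop_apply] at this
    rw [this, h', sub_self]
  exact sub_eq_zero.mp (eq_zero_of_Mfun_eq_zero hL this)

variable [FiniteDimensional ℝ E]

/-- (Green) **the lattice Green function** «`Γ := (−Δ_Ω + Q*Q)⁻¹`» (a linear automorphism of the finite-dimensional `𝓛²(Ω; E)`).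
[cite: DybalskiStottmeisterTanimoto2024, §3.3 (Green)] -/
def Gamma (hL : 0 < L) : (Site L n₁ → E) ≃ₗ[ℝ] (Site L n₁ → E) :=
  (LinearEquiv.ofInjectiveEndo (Mop L) (Mop_injective hL)).symm

/-- `(−Δ_Ω + Q*Q)Γg = g`. [cite: DybalskiStottmeisterTanimoto2024, §3.3 (Green)] -/
theorem Mfun_Gamma (hL : 0 < L) (g : Site L n₁ → E) : Mfun L (Gamma hL g) = g := by
  have h := (LinearEquiv.ofInjectiveEndo (Mop L) (Mop_injective (n₁ := n₁) (E := E) hL)).apply_symm_apply g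
  rw [LinearEquiv.coe_ofInjectiveEndo, Mop_apply] at h
  exact h

/-- `Γ(−Δ_Ω + Q*Q)f = f`. [cite: DybalskiStottmeisterTanimoto2024, §3.3 (Green)] -/
theorem Gamma_Mfun (hL : 0 < L) (f : Site L n₁ → E) : Gamma hL (Mfun L f) = f := by
  have h := (LinearEquiv.ofInjectiveEndo (Mop L) (Mop_injective (n₁ := n₁) (E := E) hL)).symm_apply_apply f
  rw [LinearEquiv.coe_ofInjectiveEndo, Mop_apply] at h
  exact h

omit [FiniteDimensional ℝ E] in
/-- `−Δ_Ω + Q*Q` is symmetric: `⟨(−Δ_Ω + Q*Q)f, g⟩ = ⟨f, (−Δ_Ω + Q*Q)g⟩`. [cite: DybalskiStottmeisterTanimoto2024, §3.3 (adjoint), (2.6); §4.2 («Hermitian»)] -/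
theorem ipS_Mfun_comm (hL : 0 < L) (f g : Site L n₁ → E) : ipS (Mfun L f) g = ipS f (Mfun L g) := by
  unfold Mfun
  rw [ipS_comm, ipS_add_right, ipS_add_right, ← ipB_del, ← ipB_del, ← ipS_Qstar_Q_symm hL, ipS_comm (Qstar L (Q L g)) f]
  congr 1
  unfold ipB
  exact Finset.sum_congr rfl fun b _ => real_inner_comm _ _

/-- **Lemma (inverse-lemma) 2. (Green-estimate)**, qualitative `𝓛²` form: «`(−Δ_Ω + Q*Q)⁻¹ ≥ c`» — `Γ > 0`: `⟨g, Γg⟩_Ω > 0` for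
`g ≠ 0` (indeed `≥ (8L⁴)⁻¹‖Γg‖²`). [cite: DybalskiStottmeisterTanimoto2024, §4.2 Lemma (inverse-lemma) 2. (Green-estimate)] -/
theorem ipS_Gamma_pos (hL : 0 < L) {g : Site L n₁ → E} (hg : g ≠ 0) : 0 < ipS g (Gamma hL g) := by
  set f := Gamma hL g with hf
  have hgf : g = Mfun L f := (Mfun_Gamma hL g).symm
  have hf0 : f ≠ 0 := by
    intro h
    apply hg
    rw [hgf, h]
    exact (Mop L).map_zero
  rw [hgf, ipS_Mfun_comm hL]
  have h1 := many_boxes hL f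
  have h2 : 0 < ipS f f := by
    rw [ipS_self]
    obtain ⟨x, hx⟩ : ∃ x, f x ≠ 0 := by
      by_contra h
      exact hf0 (funext fun x => by_contra fun hx => h ⟨x, hx⟩)
    exact lt_of_lt_of_le (by positivity) (Finset.single_le_sum (fun x _ => sq_nonneg (‖f x‖)) (Finset.mem_univ x))
  have hL4 : (0 : ℝ) < 8 * (L : ℝ) ^ 4 := by positivity
  nlinarith

/-- **Lemma (inverse-lemma) 3. (sandwiched-Green)**, qualitative `𝓛²` form: «`Q(−Δ_Ω + Q*Q)⁻¹Q* ≥ c` on `𝓛²(Ω₁)`» — `QΓQ* > 0`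
(«if a Hermitian `M` satisfies `M ≥ c` on `𝓛²(Ω)` then `QMQ* ≥ c` on `𝓛²(Ω₁)` … since `QQ* = 1`»).
[cite: DybalskiStottmeisterTanimoto2024, §4.2 Lemma (inverse-lemma) 3. (sandwiched-Green)] -/
theorem ipC_QGammaQstar_pos (hL : 0 < L) {c : CSite n₁ → E} (hc : c ≠ 0) :
    0 < ipC L (Q L (Gamma hL (Qstar L c))) c := by
  rw [ipC_Q_eq_ipS_Qstar hL, ipS_comm]
  refine ipS_Gamma_pos hL fun h => hc ?_
  rw [← Q_Qstar hL c, h]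
  funext y
  rw [Q_apply, Pi.zero_apply]
  simp

/-- `QΓQ*` as a linear operator on `𝓛²(Ω₁; E)`. [cite: DybalskiStottmeisterTanimoto2024, §4.2 Lemma (inverse-lemma) 3.] -/
def QGammaQstarOp (hL : 0 < L) : (CSite n₁ → E) →ₗ[ℝ] (CSite n₁ → E) where
  toFun c := Q L (Gamma hL (Qstar L c))
  map_add' c c' := by rw [Qstar_add, map_add, Q_add]
  map_smul' r c := by rw [Qstar_smul, map_smul, Q_smul, RingHom.id_apply]

/-- `QΓQ*` is injective (from `QΓQ* > 0`). [cite: DybalskiStottmeisterTanimoto2024, §4.2 Lemma (inverse-lemma) 3.] -/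
theorem QGammaQstar_injective (hL : 0 < L) :
    Function.Injective (QGammaQstarOp (n₁ := n₁) (E := E) hL) := by
  intro c c' h
  by_contra hne
  have hpos := ipC_QGammaQstar_pos hL (sub_ne_zero.mpr hne)
  have : Q L (Gamma hL (Qstar L (c - c'))) = 0 := by
    have e := (QGammaQstarOp (E := E) hL).map_sub c c'
    change Q L (Gamma hL (Qstar L (c - c'))) = QGammaQstarOp hL c - QGammaQstarOp hL c' at e
    rw [e, h, sub_self]
  rw [this] at hpos
  unfold ipC at hpos
  simp at hpos

/-- «`Q(−Δ_Ω + Q*Q)⁻¹Q*` … invertible»: `QΓQ*` as a linear automorphism of `𝓛²(Ω₁; E)` (first factor of the decomposition (4.35) of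
`QΓR*Q*` in the proof of Lemma (Q-G-R-Q-lemma)). [cite: DybalskiStottmeisterTanimoto2024, §4.2 Lemma (inverse-lemma) 3.; §4.4 proof of Lemma (Q-G-R-Q-lemma) («The first factor is invertible by part 3. of Lemma (inverse-lemma)»)] -/
def QGammaQstar (hL : 0 < L) : (CSite n₁ → E) ≃ₗ[ℝ] (CSite n₁ → E) :=
  LinearEquiv.ofInjectiveEndo (QGammaQstarOp hL) (QGammaQstar_injective hL)

/-- `QGammaQstar hL c = QΓQ*c`. [cite: DybalskiStottmeisterTanimoto2024, §4.2 Lemma (inverse-lemma) 3.] -/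
@[simp] theorem QGammaQstar_apply (hL : 0 < L) (c : CSite n₁ → E) : QGammaQstar hL c = Q L (Gamma hL (Qstar L c)) := rfl

end InverseLemma

end

end Literature.MathematicalPhysics.QuantumFieldTheory.DybalskiStottmeisterTanimoto2024.DST24GreenFunction
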